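import Literature.NumberTheory.DiophantineGeometry.GenEllDeBadPlaceDefect
import Literature.NumberTheory.DiophantineGeometry.GenEllDeCritDivisibility
import HarnessLib

/-!
# [GenEll] Thm 2.1 on `D_e`: the defect bound at every place, with the divisibility certificate supplied

S. Mochizuki, *Arithmetic elliptic curves in general position*, Math. J. Okayama Univ. **52** (2010),
proof of Thm. 2.1 pp. 12–13 [cite: MochizukiGenEll2010, Thm 2.1 proof pp.12-13].  Proof-only JUNCTION
file of the GenEllTwo package (abc-iut cell, stmt-ABC-19679): abc-iut-w5-d090's defect bound
`DeC.exists_defect_toNat_ord_le` (piece (F-b), `GenEllDeBadPlaceDefect.lean`) takes as a hypothesis the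
identity `∏_{β∈A}(s + c·r^{k+2} − β·rs) = N_c·(H₀(r) + s·H₁(r))` at the point; abc-iut-w5-d054's
`DeC.exists_prod_fibre_eq_N_mul'` (piece (S1)(B), `GenEllDeCritDivisibility.lean`) produces exactly such
`H₀, H₁` once `R_c` splits in `K` and `A` contains the critical values.  Composing the two gives the defect
bound with NO identity hypothesis (`DeC.exists_defect_toNat_ord_le_of_splits`), the shape consumed by the
conductor summation with defects.  Classical; theorems only; nothing here bears on [IUTchIII] Cor. 3.12.
-/

noncomputable section

open NumberField IsDedekindDomain Polynomial Finset
open Literature.IUT.LogVolume Literature.IUT.LogVolume.Cor22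

namespace Literature.NumberTheory.DiophantineGeometry.GenEll

universe v

/-- **The defect bound at every place, certificate supplied.** For `k ≥ 1`, `c ≠ 0` in a number field
`K` in which `R_c` splits, and a finite `A ⊂ K` containing every critical value `t_c(θ)` (`R_c(θ) = 0`),
there is `D ∈ ℕ` such that for every number field `L ⊇ K`, every finite place `w ∣ p` of `L` and every
point `(r, s)` of `D_e ∖ {rs = 0}` with `t·(rs) = s + c·r^{k+2}`, `N_c ≠ 0`, `t ∉ A`:
`ord⁺_w N_c ≤ Σ_{β∈A} ord⁺_w (t − β) + D·e(w∣p)` — abc-iut-w5-d090's (F-b) with its identity hypothesis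
discharged by abc-iut-w5-d054's (S1)(B). [cite: MochizukiGenEll2010, Thm 2.1 proof pp.12-13] -/
theorem DeC.exists_defect_toNat_ord_le_of_splits (p : ℕ) [Fact p.Prime] (k : ℕ) (hk : 1 ≤ k)
    {K : Type v} [Field K] [NumberField K] {c : K} (hc : c ≠ 0) (A : Finset K)
    (hsplit : (DeCrit.RpolyC k c).Splits)
    (hA : ∀ θ : K, (DeCrit.RpolyC k c).eval θ = 0 → DeCrit.tCritC k c θ ∈ A) :
    ∃ D : ℕ, ∀ (L : Type v) [Field L] [NumberField L] [Algebra K L]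
      (w : HeightOneSpectrum (𝓞 L)), w ∈ placesOver L p → ∀ (r s t N : L),
      s ^ 2 = 1 - 4 * r ^ (2 * k + 1) → t * (r * s) = s + algebraMap K L c * r ^ (k + 2) →
      N = -s ^ 3 + algebraMap K L c * ((k + 1) * r ^ (k + 2) - 2 * r ^ (3 * k + 3)) →
      r ≠ 0 → s ≠ 0 → N ≠ 0 → (∀ β ∈ A, t ≠ algebraMap K L β) →
      (ord L w N).toNat ≤ (∑ β ∈ A, (ord L w (t - algebraMap K L β)).toNat) + D * ramIdx L w := by
  obtain ⟨H₀, H₁, hH⟩ := DeC.exists_prod_fibre_eq_N_mul' k hc A hsplit hA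
  obtain ⟨D, hD⟩ := DeC.exists_defect_toNat_ord_le p k hk hc A H₀ H₁
  exact ⟨D, fun L _ _ _ w hw r s t N hcurve ht hN hr hs hN0 htA =>
    hD L w hw r s t N hcurve ht hN hr hs hN0 htA (hH L r s N hcurve hN)⟩

end Literature.NumberTheory.DiophantineGeometry.GenEll

end
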